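import Literature.Computability.FineGrained.SparsifierRoutines
import HarnessLib

/-!
# The sparsification algorithm as a stack program, II: the operator Θ

Family `fine-grained` (trunk T-CPLX-FINE), continuing `SparsifierRoutines.lean`. This file
programs and verifies the first step performed at every node of the recursion tree of the
algorithm `Reduce` of Impagliazzo–Paturi–Zane (JCSS 63 (2001), §2, line 1 of `Reduce`:
`S ← Θ(S)`): with the current family of clauses held as a family word in register `cur`,
`theta` leaves in register `acc` the word of the list of its minimal members without
repetitions, computed online — a clause `c` is discarded if some kept clause is contained in it,
and otherwise it evicts the kept clauses containing it and is appended (`thetaStep`, `thetaL`;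
that this list enumerates the antichain `Sparsification.minimals` of the family is proved with
the list-level model of the whole program).

* `Clean`, `ThetaClean` — the scratch registers that must be (and are left) empty;
* `thetaPass1` / `runs_thetaPass1` — is some kept clause contained in the new one? (a
  `famPass` over `acc` running `subDC` on each kept clause, hits counted in unary on `drop`);
* `thetaPass2` / `runs_thetaPass2` — evict the kept clauses containing the new one and append it
  (a second `famPass`, the inclusion being tested the other way round by exchanging the operand
  registers of `subDC`);
* `theta` / `runs_theta` — the whole pass, with the step bound `cTheta L kk n`, a polynomial in
  the literal length bound `L`, the clause length bound `kk` and the number of clauses `n`.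

## References

* R. Impagliazzo, R. Paturi, F. Zane, *Which problems have strongly exponential complexity?*,
  J. Comput. Syst. Sci. 63 (2001) 512–530, §2 (algorithm `Reduce`, the operator `Θ`).
-/

namespace Literature.Computability.FineGrained.Sparsifier

open _root_.Computability Complexity Complexity.ACom

/-! ### The operator Θ: minimal members, without repetitions -/

/-- One online step of `Θ`: the new clause `c` is discarded if a kept clause is contained in it;
otherwise the kept clauses containing `c` are evicted and `c` is appended.
[cite: ImpagliazzoPaturiZaneJCSS2001, §2 (the operator Θ)] -/
def thetaStep (acc : List (List Lit)) (c : List Lit) : List (List Lit) :=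
  if ∃ d ∈ acc, d ⊆ c then acc else acc.filter (fun d => ¬ c ⊆ d) ++ [c]

/-- `Θ` on a list of clauses, online. [cite: ImpagliazzoPaturiZaneJCSS2001, §2 (the operator Θ)] -/
def thetaL (F : List (List Lit)) : List (List Lit) := F.foldl thetaStep []

/-- The length of a clause body in terms of a bound on its literals. [folklore] -/
theorem length_cbody_le {c : List Lit} {L : ℕ} (hL : ∀ l ∈ c, (litBody l).length ≤ L) :
    (cbody c).length ≤ (L + 1) * c.length := by
  induction c with
  | nil => simp
  | cons a c ih =>
    have e1 := hL a List.mem_cons_self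
    have e2 := ih (fun l' h => hL l' (List.mem_cons_of_mem _ h))
    simp only [cbody_cons, List.length_append, List.length_cons]
    nlinarith

/-- The length of a family word. [folklore] -/
theorem length_wFam_le {F : List (List Lit)} {W : ℕ} (hW : ∀ c ∈ F, (cbody c).length ≤ W) :
    (wFam F).length ≤ (W + 2) * F.length := by
  induction F with
  | nil => simp
  | cons c F ih =>
    have e1 := hW c List.mem_cons_self
    have e2 := ih (fun c' h => hW c' (List.mem_cons_of_mem _ h))
    simp only [wFam_cons, List.length_cons, List.length_append]
    nlinarith

/-! #### Clean scratch registers -/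

/-- The scratch registers of the clause-level routines are empty. [folklore] -/
structure Clean (T : Store) : Prop where
  (x : T K.x = []) (x2 : T K.x2 = []) (y : T K.y = []) (ne : T K.ne = []) (fl : T K.fl = [])
  (fl2 : T K.fl2 = []) (c2 : T K.c2 = []) (d2 : T K.d2 = [])

/-- The scratch registers, as a list. [folklore] -/
def scratch : List K := [K.x, K.x2, K.y, K.ne, K.fl, K.fl2, K.c2, K.d2]

/-- `Clean` from emptiness of the listed registers. [folklore] -/
theorem clean_of_forall {T : Store} (h : ∀ r ∈ scratch, T r = []) : Clean T :=
  ⟨h _ (by simp [scratch]), h _ (by simp [scratch]), h _ (by simp [scratch]),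
    h _ (by simp [scratch]), h _ (by simp [scratch]), h _ (by simp [scratch]),
    h _ (by simp [scratch]), h _ (by simp [scratch])⟩

/-- The listed registers are empty in a clean store. [folklore] -/
theorem Clean.forall {T : Store} (h : Clean T) : ∀ r ∈ scratch, T r = [] := by
  intro r hr
  simp only [scratch, List.mem_cons, List.not_mem_nil, or_false] at hr
  rcases hr with rfl | rfl | rfl | rfl | rfl | rfl | rfl | rfl
  exacts [h.x, h.x2, h.y, h.ne, h.fl, h.fl2, h.c2, h.d2]

/-- Updating a non-scratch register keeps the store clean. [folklore] -/
theorem Clean.update {T : Store} (h : Clean T) {r : K} (hr : r ∉ scratch) (v : List Γ') :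
    Clean (Function.update T r v) := by
  refine clean_of_forall fun r' hr' => ?_
  have hne : r' ≠ r := fun e => hr (e ▸ hr')
  rw [Function.update_of_ne hne, h.forall r' hr']

/-! #### First pass: is some kept clause contained in the new clause? -/

/-- Action of the first pass: bring the kept clause `d` in reading order, test `d ⊆ c`, record
a hit on `drop`. [folklore] -/
def th1Act : Prog :=
  pour K.pt K.d ;; subDC ;; pop K.fl2 (fun o => match o with
    | some _ => skip
    | none => push K.drop Γ'.blank) ;; clear K.d

/-- First pass of `Θ` over the kept clauses in `acc` (restored afterwards). [folklore] -/
def thetaPass1 : Prog := loop K.acc (famPass K.acc2 K.pt th1Act) ;; pour K.acc2 K.acc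

/-- Cost of `th1Act` in terms of the literal bound `L` and the clause bound `kk`. [folklore] -/
def cTh1 (L kk : ℕ) : ℕ := 42 * (L + 1) * (kk + 1) * kk + 5 * ((L + 1) * kk) + 12

/-- Cost of `thetaPass1` over `m` kept clauses. [folklore] -/
def cPass1 (L kk m : ℕ) : ℕ :=
  (4 * ((L + 1) * kk) + cTh1 L kk + 6) * m + 3 * (((L + 1) * kk + 2) * m) + 2

/-- **First pass of `Θ`.** With `acc = wFam accL`, `c = cbody c₀` and the scratch registers empty,
`thetaPass1` restores `acc` and sets `drop` to the unary count of the kept clauses contained in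
`c₀`. [folklore] -/
theorem runs_thetaPass1 (accL : List (List Lit)) (c₀ : List Lit) (L kk : ℕ)
    (hLa : ∀ d ∈ accL, ∀ l ∈ d, (litBody l).length ≤ L) (hka : ∀ d ∈ accL, d.length ≤ kk)
    (hLc : ∀ l ∈ c₀, (litBody l).length ≤ L) (hkc : c₀.length ≤ kk) (T : Store)
    (hacc : T K.acc = wFam accL) (hc : T K.c = cbody c₀) (hpt : T K.pt = [])
    (hacc2 : T K.acc2 = []) (hd : T K.d = []) (hdrop : T K.drop = []) (hT : Clean T) :
    Runs thetaPass1 T (Function.update T K.drop (unary (accL.countP fun d => d ⊆ c₀)))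
      (cPass1 L kk accL.length) := by
  obtain ⟨hx, hx2, hy, hne, hfl, hfl2, hc2, hd2⟩ := hT
  unfold thetaPass1
  set W := (L + 1) * kk with hW
  have hWd : ∀ d ∈ accL, (cbody d).length ≤ W := fun d hd' =>
    (length_cbody_le (hLa d hd')).trans (by rw [hW]; exact Nat.mul_le_mul_left _ (hka d hd'))
  set St : List (List Lit) → List (List Lit) → Store := fun done rest =>
    Function.update (Function.update (Function.update T K.acc (wFam rest)) K.acc2
      (wFam done).reverse) K.drop (unary (done.countP fun d => d ⊆ c₀)) with hSt
  have hpass := runs_famPass (reg := K.acc) (sv := K.acc2) (ca := K.pt) th1Act (by decide)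
    (by decide) (by decide) St accL W (cTh1 L kk)
    (fun done rest => by simp [hSt])
    (fun done rest => by simp [hSt, hpt])
    (fun done d rest hfull hdW => by
      have hdmem : d ∈ accL := by rw [← hfull]; simp
      have hLd := hLa d hdmem
      have hkd := hka d hdmem
      unfold th1Act
      set P := famPre K.acc K.acc2 K.pt (St done (d :: rest)) d rest with hP
      -- bring `d` in reading order
      have e1 := runs_pour (a := K.pt) (b := K.d) (by decide) P
      have hPpt : P K.pt = (cbody d).reverse := by simp [hP, famPre, hSt, hpt]
      have hPd : P K.d = [] := by simp [hP, famPre, hSt, hd]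
      rw [hPpt, hPd, List.length_reverse, List.reverse_reverse, List.append_nil] at e1
      set P₁ := Function.update (Function.update P K.pt []) K.d (cbody d) with hP₁
      -- the inclusion test
      have e2 := runs_subDC d c₀ L hLd hLc P₁ (by simp [hP₁]) (by simp [hP₁, hP, famPre, hSt, hc])
        (by simp [hP₁, hP, famPre, hSt, hx]) (by simp [hP₁, hP, famPre, hSt, hd2])
        (by simp [hP₁, hP, famPre, hSt, hfl2]) (by simp [hP₁, hP, famPre, hSt, hc2])
        (by simp [hP₁, hP, famPre, hSt, hy]) (by simp [hP₁, hP, famPre, hSt, hx2])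
        (by simp [hP₁, hP, famPre, hSt, hne]) (by simp [hP₁, hP, famPre, hSt, hfl])
      set P₂ := Function.update P₁ K.fl2 (flag (¬ d ⊆ c₀)) with hP₂
      -- record a hit
      set P₃ := Function.update (Function.update P₂ K.fl2 []) K.drop
        ((if d ⊆ c₀ then [Γ'.blank] else []) ++ P K.drop) with hP₃
      have e3 : Runs (pop K.fl2 fun o => match o with
          | some _ => skip
          | none => push K.drop Γ'.blank) P₂ P₃ 3 := by
        by_cases hdc : d ⊆ c₀
        · have hk : P₂ K.fl2 = [] := by simp [hP₂, flag, hdc]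
          refine (Runs.pop_nil hk (Runs.push' ?_)).mono (by norm_num)
          rw [hP₃, if_pos hdc]
          funext r; cases r <;> simp [hP₂, hP₁, flag, hdc]
        · have hk : P₂ K.fl2 = [Γ'.blank] := by simp [hP₂, flag, hdc]
          refine (Runs.pop_cons hk ((Runs.skip _).of_eq ?_ le_rfl)).mono (by norm_num)
          rw [hP₃, if_neg hdc]
          funext r; cases r <;> simp [hP₂, hP₁]
      -- clear `d`
      have e4 := runs_clear K.d P₃
      have hP₃d : P₃ K.d = cbody d := by simp [hP₃, hP₂, hP₁]
      rw [hP₃d] at e4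
      have := e1.seq (e2.seq (e3.seq e4))
      refine this.of_eq ?_ ?_
      · rw [hP₃, hP₂, hP₁, hP]
        simp only [famPre, hSt]
        by_cases hdc : d ⊆ c₀
        · funext r; cases r <;> simp [hdc, hd, hpt, hfl2, wFam_append, wFam_cons,
            List.countP_append, unary_succ]
        · funext r; cases r <;> simp [hdc, hd, hpt, hfl2, wFam_append, wFam_cons,
            List.countP_append]
      · have h1 : (cbody d).length ≤ W := hWd d hdmem
        have h2 : 42 * (L + 1) * (c₀.length + 1) * d.length ≤ 42 * (L + 1) * (kk + 1) * kk := by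
          have := Nat.mul_le_mul (Nat.mul_le_mul_left (42 * (L + 1)) (Nat.succ_le_succ hkc)) hkd
          simpa [Nat.mul_assoc] using this
        simp only [cTh1, hW] at h1 ⊢
        omega)
    accL [] rfl hWd
  have hSt0 : St [] accL = T := by
    funext r; cases r <;> simp [hSt, hacc, hacc2, hdrop]
  rw [hSt0, List.nil_append] at hpass
  set T₁ := St accL [] with hT₁
  have e5 := runs_pour (a := K.acc2) (b := K.acc) (by decide) T₁
  have hT₁acc2 : T₁ K.acc2 = (wFam accL).reverse := by simp [hT₁, hSt]
  have hT₁acc : T₁ K.acc = [] := by simp [hT₁, hSt]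
  rw [hT₁acc2, hT₁acc, List.length_reverse, List.reverse_reverse, List.append_nil] at e5
  have := hpass.seq e5
  refine this.of_eq ?_ ?_
  · rw [hT₁]
    simp only [hSt]
    funext r; cases r <;> simp [hacc, hacc2]
  · have hlen : (wFam accL).length ≤ (W + 2) * accL.length := length_wFam_le hWd
    simp only [cPass1, ← hW]
    omega

/-! #### Second pass: evict the kept clauses containing the new clause, then append it -/

/-- Emit the clause body held in `d` as a bracketed clause onto `dst` (reversed), emptying `d`.
[folklore] -/
def emitD (dst : K) : Prog := push dst Γ'.bra ;; pour K.d dst ;; push dst Γ'.ket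

/-- Effect and cost of `emitD`. [folklore] -/
theorem runs_emitD {dst : K} (h : dst ≠ K.d) (R : Store) :
    Runs (emitD dst) R (Function.update (Function.update R K.d []) dst
      ((Γ'.bra :: R K.d ++ [Γ'.ket]).reverse ++ R dst)) (3 * (R K.d).length + 3) := by
  unfold emitD
  have e1 := Runs.push dst Γ'.bra R
  have e2 := runs_pour (a := K.d) (b := dst) h.symm (Function.update R dst (Γ'.bra :: R dst))
  rw [Function.update_of_ne h.symm, Function.update_self] at e2
  have e3 := Runs.push dst Γ'.ket (Function.update (Function.update (Function.update R dst
    (Γ'.bra :: R dst)) K.d []) dst ((R K.d).reverse ++ Γ'.bra :: R dst))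
  refine (e1.seq (e2.seq e3)).of_eq ?_ (by omega)
  funext r
  rcases eq_or_ne dst r with rfl | hr
  · simp
  · rcases eq_or_ne K.d r with rfl | hr'
    · simp [Function.update_of_ne h.symm]
    · simp [Function.update_of_ne hr.symm, Function.update_of_ne hr'.symm]

/-- Action of the second pass: bring the kept clause `d` in reading order, test `c ⊆ d` (by
exchanging the operand registers around `subDC`), and keep `d` (on `keep`) iff the test fails.
[folklore] -/
def th2Act : Prog :=
  pour K.pt K.d ;; swap K.c K.d K.s K.s2 ;; subDC ;; swap K.c K.d K.s K.s2 ;;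
  pop K.fl2 fun o => match o with
    | some _ => emitD K.keep
    | none => clear K.d

/-- Second pass of `Θ`: filter the kept clauses, append the new clause, and put the result back
in `acc`. [folklore] -/
def thetaPass2 : Prog :=
  loop K.acc (famPass K.j2 K.pt th2Act) ;; clear K.j2 ;;
  push K.keep Γ'.bra ;; pour K.c K.keep ;; push K.keep Γ'.ket ;; pour K.keep K.acc

/-- Cost of `th2Act`. [folklore] -/
def cTh2 (L kk : ℕ) : ℕ := 42 * (L + 1) * (kk + 1) * kk + 30 * ((L + 1) * kk) + 24

/-- Cost of `thetaPass2` over `m` kept clauses. [folklore] -/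
def cPass2 (L kk m : ℕ) : ℕ :=
  (4 * ((L + 1) * kk) + cTh2 L kk + 6) * m + 2 * (((L + 1) * kk + 2) * m) +
    3 * (((L + 1) * kk + 2) * (m + 1)) + 3 * ((L + 1) * kk) + 8

/-- **Second pass of `Θ`.** With `acc = wFam accL`, `c = cbody c₀`,
`keep = j2 = pt = d = s = s2 = []` and a clean store, `thetaPass2` empties `c` and sets `acc` to
the word of `accL.filter (¬ c₀ ⊆ ·) ++ [c₀]`. [folklore] -/
theorem runs_thetaPass2 (accL : List (List Lit)) (c₀ : List Lit) (L kk : ℕ)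
    (hLa : ∀ d ∈ accL, ∀ l ∈ d, (litBody l).length ≤ L) (hka : ∀ d ∈ accL, d.length ≤ kk)
    (hLc : ∀ l ∈ c₀, (litBody l).length ≤ L) (hkc : c₀.length ≤ kk) (T : Store)
    (hacc : T K.acc = wFam accL) (hc : T K.c = cbody c₀) (hpt : T K.pt = [])
    (hkeep : T K.keep = []) (hj2 : T K.j2 = []) (hd : T K.d = []) (hs : T K.s = [])
    (hs2 : T K.s2 = []) (hT : Clean T) :
    Runs thetaPass2 T (Function.update (Function.update T K.c []) K.acc
      (wFam (accL.filter (fun d => ¬ c₀ ⊆ d) ++ [c₀]))) (cPass2 L kk accL.length) := by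
  obtain ⟨hx, hx2, hy, hne, hfl, hfl2, hc2, hd2⟩ := hT
  unfold thetaPass2
  set W := (L + 1) * kk with hW
  have hWd : ∀ d ∈ accL, (cbody d).length ≤ W := fun d hd' =>
    (length_cbody_le (hLa d hd')).trans (by rw [hW]; exact Nat.mul_le_mul_left _ (hka d hd'))
  have hWc : (cbody c₀).length ≤ W :=
    (length_cbody_le hLc).trans (by rw [hW]; exact Nat.mul_le_mul_left _ hkc)
  set St : List (List Lit) → List (List Lit) → Store := fun done rest =>
    Function.update (Function.update (Function.update T K.acc (wFam rest)) K.j2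
      (wFam done).reverse) K.keep (wFam (done.filter fun d => ¬ c₀ ⊆ d)).reverse with hSt
  have hpass := runs_famPass (reg := K.acc) (sv := K.j2) (ca := K.pt) th2Act (by decide)
    (by decide) (by decide) St accL W (cTh2 L kk)
    (fun done rest => by simp [hSt])
    (fun done rest => by simp [hSt, hpt])
    (fun done d rest hfull hdW => by
      have hdmem : d ∈ accL := by rw [← hfull]; simp
      have hLd := hLa d hdmem
      have hkd := hka d hdmem
      unfold th2Act
      set P := famPre K.acc K.j2 K.pt (St done (d :: rest)) d rest with hP
      have hPv : ∀ r, r ≠ K.acc → r ≠ K.j2 → r ≠ K.pt → r ≠ K.keep → P r = T r := by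
        intro r h1 h2 h3 h4
        simp [hP, famPre, hSt, Function.update_of_ne h1, Function.update_of_ne h2,
          Function.update_of_ne h3, Function.update_of_ne h4]
      -- bring `d` in reading order
      have e1 := runs_pour (a := K.pt) (b := K.d) (by decide) P
      have hPpt : P K.pt = (cbody d).reverse := by simp [hP, famPre, hSt, hpt]
      have hPd : P K.d = [] := by rw [hPv K.d (by decide) (by decide) (by decide) (by decide), hd]
      rw [hPpt, hPd, List.length_reverse, List.reverse_reverse, List.append_nil] at e1
      set P₁ := Function.update (Function.update P K.pt []) K.d (cbody d) with hP₁
      have hP₁v : ∀ r, r ≠ K.acc → r ≠ K.j2 → r ≠ K.pt → r ≠ K.keep → r ≠ K.d → P₁ r = T r := by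
        intro r h1 h2 h3 h4 h5
        rw [hP₁, Function.update_of_ne h5, Function.update_of_ne h3, hPv r h1 h2 h3 h4]
      -- exchange the operands
      have e2 := runs_swap (a := K.c) (b := K.d) (t₁ := K.s) (t₂ := K.s2) (by decide) (by decide)
        (by decide) (by decide) (by decide) (by decide) P₁
        (by rw [hP₁v K.s (by decide) (by decide) (by decide) (by decide) (by decide), hs])
        (by rw [hP₁v K.s2 (by decide) (by decide) (by decide) (by decide) (by decide), hs2])
      have hP₁c : P₁ K.c = cbody c₀ := by
        rw [hP₁v K.c (by decide) (by decide) (by decide) (by decide) (by decide), hc]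
      have hP₁d : P₁ K.d = cbody d := by simp [hP₁]
      rw [hP₁c, hP₁d] at e2
      set P₂ := Function.update (Function.update P₁ K.c (cbody d)) K.d (cbody c₀) with hP₂
      have hP₂v : ∀ r, r ≠ K.acc → r ≠ K.j2 → r ≠ K.pt → r ≠ K.keep → r ≠ K.d → r ≠ K.c →
          P₂ r = T r := by
        intro r h1 h2 h3 h4 h5 h6
        rw [hP₂, Function.update_of_ne h5, Function.update_of_ne h6, hP₁v r h1 h2 h3 h4 h5]
      -- the inclusion test `c₀ ⊆ d`
      have e3 := runs_subDC c₀ d L hLc hLd P₂ (by simp [hP₂]) (by simp [hP₂])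
        (by rw [hP₂v K.x (by decide) (by decide) (by decide)
          (by decide) (by decide) (by decide), hx])
        (by rw [hP₂v K.d2 (by decide) (by decide) (by decide)
          (by decide) (by decide) (by decide), hd2])
        (by rw [hP₂v K.fl2 (by decide) (by decide) (by decide)
          (by decide) (by decide) (by decide), hfl2])
        (by rw [hP₂v K.c2 (by decide) (by decide) (by decide)
          (by decide) (by decide) (by decide), hc2])
        (by rw [hP₂v K.y (by decide) (by decide) (by decide)
          (by decide) (by decide) (by decide), hy])
        (by rw [hP₂v K.x2 (by decide) (by decide) (by decide)
          (by decide) (by decide) (by decide), hx2])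
        (by rw [hP₂v K.ne (by decide) (by decide) (by decide)
          (by decide) (by decide) (by decide), hne])
        (by rw [hP₂v K.fl (by decide) (by decide) (by decide)
          (by decide) (by decide) (by decide), hfl])
      set P₃ := Function.update P₂ K.fl2 (flag (¬ c₀ ⊆ d)) with hP₃
      -- exchange back
      have e4 := runs_swap (a := K.c) (b := K.d) (t₁ := K.s) (t₂ := K.s2) (by decide) (by decide)
        (by decide) (by decide) (by decide) (by decide) P₃
        (by rw [hP₃, Function.update_of_ne (by decide), hP₂v K.s (by decide) (by decide)
          (by decide) (by decide) (by decide) (by decide), hs])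
        (by rw [hP₃, Function.update_of_ne (by decide), hP₂v K.s2 (by decide) (by decide)
          (by decide) (by decide) (by decide) (by decide), hs2])
      have hP₃c : P₃ K.c = cbody d := by simp [hP₃, hP₂]
      have hP₃d : P₃ K.d = cbody c₀ := by simp [hP₃, hP₂]
      rw [hP₃c, hP₃d] at e4
      set P₄ := Function.update (Function.update P₃ K.c (cbody c₀)) K.d (cbody d) with hP₄
      -- keep or evict
      set P₅ := Function.update (Function.update (Function.update P₄ K.fl2 []) K.d []) K.keep
        ((if c₀ ⊆ d then [] else (Γ'.bra :: cbody d ++ [Γ'.ket]).reverse) ++ P K.keep) with hP₅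
      have hP₄keep : P₄ K.keep = P K.keep := by
        simp [hP₄, hP₃, hP₂, hP₁]
      have e5 : Runs (pop K.fl2 fun o => match o with
          | some _ => emitD K.keep
          | none => clear K.d) P₄ P₅ (3 * W + 5) := by
        by_cases hcd : c₀ ⊆ d
        · have hk : P₄ K.fl2 = [] := by simp [hP₄, hP₃, flag, hcd]
          have ec := runs_clear K.d P₄
          have hv : P₄ K.d = cbody d := by simp [hP₄]
          rw [hv] at ec
          have hupd : Function.update P₄ K.fl2 [] = P₄ := by
            rw [← hk]; exact Function.update_eq_self _ _
          refine (Runs.pop_nil hk (ec.of_eq ?_ le_rfl)).mono (by omega)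
          rw [hP₅, if_pos hcd, List.nil_append, ← hP₄keep, hupd]
          exact (Function.update_eq_self_iff.2 (by simp)).symm
        · have hk : P₄ K.fl2 = [Γ'.blank] := by simp [hP₄, hP₃, flag, hcd]
          have ee := runs_emitD (dst := K.keep) (by decide) (Function.update P₄ K.fl2 [])
          have hv : Function.update P₄ K.fl2 [] K.d = cbody d := by simp [hP₄]
          rw [hv] at ee
          refine (Runs.pop_cons hk (ee.of_eq ?_ le_rfl)).mono (by omega)
          rw [hP₅, if_neg hcd, ← hP₄keep]
          simp
      have := e1.seq (e2.seq (e3.seq (e4.seq e5)))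
      refine this.of_eq ?_ ?_
      · rw [hP₅, hP₄, hP₃, hP₂, hP₁, hP]
        simp only [famPre, hSt]
        by_cases hcd : c₀ ⊆ d
        · funext r; cases r <;> simp [hcd, hd, hpt, hfl2, hc, wFam_append, wFam_cons,
            List.filter_append]
        · funext r; cases r <;> simp [hcd, hd, hpt, hfl2, hc, wFam_append, wFam_cons,
            List.filter_append]
      · have h1 : (cbody d).length ≤ W := hWd d hdmem
        have h2 : 42 * (L + 1) * (d.length + 1) * c₀.length ≤ 42 * (L + 1) * (kk + 1) * kk := by
          have := Nat.mul_le_mul (Nat.mul_le_mul_left (42 * (L + 1)) (Nat.succ_le_succ hkd)) hkc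
          simpa [Nat.mul_assoc] using this
        simp only [cTh2, hW] at h1 hWc ⊢
        omega)
    accL [] rfl hWd
  have hSt0 : St [] accL = T := by
    funext r; cases r <;> simp [hSt, hacc, hj2, hkeep]
  rw [hSt0, List.nil_append] at hpass
  set kept := accL.filter (fun d => ¬ c₀ ⊆ d) with hkept
  set T₁ := St accL [] with hT₁
  -- clear the junk copy
  have e6 := runs_clear K.j2 T₁
  have hT₁j2 : T₁ K.j2 = (wFam accL).reverse := by simp [hT₁, hSt]
  rw [hT₁j2, List.length_reverse] at e6
  set T₂ := Function.update T₁ K.j2 [] with hT₂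
  -- append the new clause
  have e7 := Runs.push K.keep Γ'.bra T₂
  set T₃ := Function.update T₂ K.keep (Γ'.bra :: T₂ K.keep) with hT₃
  have e8 := runs_pour (a := K.c) (b := K.keep) (by decide) T₃
  have hT₃c : T₃ K.c = cbody c₀ := by simp [hT₃, hT₂, hT₁, hSt, hc]
  have hT₃keep : T₃ K.keep = Γ'.bra :: (wFam kept).reverse := by simp [hT₃, hT₂, hT₁, hSt, hkept]
  rw [hT₃c, hT₃keep] at e8
  set T₄ := Function.update (Function.update T₃ K.c []) K.keep
    ((cbody c₀).reverse ++ Γ'.bra :: (wFam kept).reverse) with hT₄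
  have e9 := Runs.push K.keep Γ'.ket T₄
  set T₅ := Function.update T₄ K.keep (Γ'.ket :: T₄ K.keep) with hT₅
  have e10 := runs_pour (a := K.keep) (b := K.acc) (by decide) T₅
  have hT₅keep : T₅ K.keep = (wFam (kept ++ [c₀])).reverse := by
    simp [hT₅, hT₄, wFam_append, wFam_cons]
  have hT₅acc : T₅ K.acc = [] := by simp [hT₅, hT₄, hT₃, hT₂, hT₁, hSt]
  rw [hT₅keep, hT₅acc, List.length_reverse, List.reverse_reverse, List.append_nil] at e10
  have := hpass.seq (e6.seq (e7.seq (e8.seq (e9.seq e10))))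
  refine this.of_eq ?_ ?_
  · rw [hT₅, hT₄, hT₃, hT₂, hT₁]
    simp only [hSt]
    funext r; cases r <;> simp [hj2, hkeep, hkept, wFam_append, wFam_cons]
  · have hlen : (wFam accL).length ≤ (W + 2) * accL.length := length_wFam_le hWd
    have hkl : kept.length ≤ accL.length := List.length_filter_le _ _
    have hWk : ∀ d ∈ kept ++ [c₀], (cbody d).length ≤ W := by
      intro d hd'
      rw [List.mem_append, List.mem_singleton] at hd'
      rcases hd' with hd' | rfl
      · exact hWd d (List.mem_of_mem_filter hd')
      · exact hWc
    have hlen2 : (wFam (kept ++ [c₀])).length ≤ (W + 2) * (accL.length + 1) :=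
      (length_wFam_le hWk).trans (Nat.mul_le_mul_left _ (by simp; omega))
    simp only [cPass2, ← hW]
    omega

/-! #### The Θ pass -/

/-- Members of an online `Θ` computation come from the accumulator or the input. [folklore] -/
theorem mem_foldl_thetaStep {d : List Lit} : ∀ (F acc : List (List Lit)),
    d ∈ F.foldl thetaStep acc → d ∈ acc ∨ d ∈ F
  | [], acc, h => Or.inl h
  | c :: F, acc, h => by
    rcases mem_foldl_thetaStep F _ h with h | h
    · unfold thetaStep at h
      split_ifs at h
      · exact Or.inl h
      · rw [List.mem_append, List.mem_singleton] at h
        rcases h with h | rfl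
        · exact Or.inl (List.mem_of_mem_filter h)
        · exact Or.inr List.mem_cons_self
    · exact Or.inr (List.mem_cons_of_mem _ h)

/-- Members of `thetaL F` are members of `F`. [folklore] -/
theorem mem_of_mem_thetaL {d : List Lit} {F : List (List Lit)} (h : d ∈ thetaL F) : d ∈ F := by
  rcases mem_foldl_thetaStep F [] h with h | h
  · simp at h
  · exact h

/-- One online step adds at most one clause. [folklore] -/
theorem length_thetaStep_le (acc : List (List Lit)) (c : List Lit) :
    (thetaStep acc c).length ≤ acc.length + 1 := by
  unfold thetaStep
  split_ifs
  · omega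
  · rw [List.length_append, List.length_singleton]
    exact Nat.succ_le_succ (List.length_filter_le _ _)

/-- The online `Θ` computation has at most as many clauses as processed. [folklore] -/
theorem length_foldl_thetaStep_le : ∀ (F acc : List (List Lit)),
    (F.foldl thetaStep acc).length ≤ acc.length + F.length
  | [], acc => by simp
  | c :: F, acc => by
    have := length_foldl_thetaStep_le F (thetaStep acc c)
    have := length_thetaStep_le acc c
    simp only [List.foldl_cons, List.length_cons]
    omega

/-- Monotonicity of `cPass1` in the number of clauses. [folklore] -/
theorem cPass1_mono (L kk : ℕ) {m n : ℕ} (h : m ≤ n) : cPass1 L kk m ≤ cPass1 L kk n := by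
  unfold cPass1; gcongr

/-- Monotonicity of `cPass2` in the number of clauses. [folklore] -/
theorem cPass2_mono (L kk : ℕ) {m n : ℕ} (h : m ≤ n) : cPass2 L kk m ≤ cPass2 L kk n := by
  unfold cPass2; gcongr

/-- Action of the `Θ` pass on a new clause: bring it in reading order, run the first pass, and
either discard it or run the second pass.
[cite: ImpagliazzoPaturiZaneJCSS2001, §2 (the operator Θ)] -/
def thetaAct : Prog :=
  pour K.cacc K.c ;; thetaPass1 ;;
  ifTop K.drop fun o => match o with
    | some _ => clear K.drop ;; clear K.c
    | none => thetaPass2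

/-- `theta`: with a family word in `cur` and `acc` empty, leave in `acc` the word of `thetaL` of
the family (and `cur` empty). [cite: ImpagliazzoPaturiZaneJCSS2001, §2 (line 1 of Reduce)] -/
def theta : Prog := loop K.cur (famPass K.j1 K.cacc thetaAct) ;; clear K.j1

/-- Cost of `thetaAct` with `n` clauses in play. [folklore] -/
def cThAct (L kk n : ℕ) : ℕ :=
  3 * ((L + 1) * kk) + cPass1 L kk n + (2 * n + 2 * ((L + 1) * kk) + 2) + cPass2 L kk n + 7

/-- Cost of `theta` on a family of `n` clauses. [folklore] -/
def cTheta (L kk n : ℕ) : ℕ :=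
  (4 * ((L + 1) * kk) + cThAct L kk n + 6) * n + 2 * (((L + 1) * kk + 2) * n) + 2

/-- The registers that `theta` needs empty besides the clean scratch registers. [folklore] -/
structure ThetaClean (T : Store) : Prop where
  (acc : T K.acc = []) (j1 : T K.j1 = []) (cacc : T K.cacc = []) (c : T K.c = [])
  (pt : T K.pt = []) (keep : T K.keep = []) (j2 : T K.j2 = []) (d : T K.d = [])
  (s : T K.s = []) (s2 : T K.s2 = []) (drop : T K.drop = []) (acc2 : T K.acc2 = [])

/-- **Specification of `theta`.** [cite: ImpagliazzoPaturiZaneJCSS2001, §2 (the operator Θ)] -/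
theorem runs_theta (F : List (List Lit)) (L kk : ℕ)
    (hLF : ∀ c ∈ F, ∀ l ∈ c, (litBody l).length ≤ L) (hkF : ∀ c ∈ F, c.length ≤ kk) (T : Store)
    (hcur : T K.cur = wFam F) (hT : Clean T) (hT' : ThetaClean T) :
    Runs theta T (Function.update (Function.update T K.cur []) K.acc (wFam (thetaL F)))
      (cTheta L kk F.length) := by
  obtain ⟨hx, hx2, hy, hne, hfl, hfl2, hc2, hd2⟩ := hT
  obtain ⟨hacc, hj1, hcacc, hc, hpt, hkeep, hj2, hd, hs, hs2, hdrop, hacc2⟩ := hT'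
  unfold theta
  set W := (L + 1) * kk with hW
  have hWF : ∀ c ∈ F, (cbody c).length ≤ W := fun c hc' =>
    (length_cbody_le (hLF c hc')).trans (by rw [hW]; exact Nat.mul_le_mul_left _ (hkF c hc'))
  set St : List (List Lit) → List (List Lit) → Store := fun done rest =>
    Function.update (Function.update (Function.update T K.cur (wFam rest)) K.j1
      (wFam done).reverse) K.acc (wFam (done.foldl thetaStep [])) with hSt
  have hpass := runs_famPass (reg := K.cur) (sv := K.j1) (ca := K.cacc) thetaAct (by decide)
    (by decide) (by decide) St F W (cThAct L kk F.length)
    (fun done rest => by simp [hSt])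
    (fun done rest => by simp [hSt, hcacc])
    (fun done c₀ rest hfull hcW => by
      have hcmem : c₀ ∈ F := by rw [← hfull]; simp
      have hLc := hLF c₀ hcmem
      have hkc := hkF c₀ hcmem
      set A := done.foldl thetaStep [] with hA
      have hAmem : ∀ d ∈ A, d ∈ F := fun d hd' => by
        rcases mem_foldl_thetaStep done [] hd' with h | h
        · simp at h
        · rw [← hfull]; exact List.mem_append_left _ h
      have hLa : ∀ d ∈ A, ∀ l ∈ d, (litBody l).length ≤ L := fun d hd' => hLF d (hAmem d hd')
      have hka : ∀ d ∈ A, d.length ≤ kk := fun d hd' => hkF d (hAmem d hd')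
      have hAlen : A.length ≤ F.length := by
        have h1 := length_foldl_thetaStep_le done []
        have h2 : done.length ≤ F.length := by rw [← hfull]; simp
        rw [← hA, List.length_nil, Nat.zero_add] at h1
        exact h1.trans h2
      unfold thetaAct
      set P := famPre K.cur K.j1 K.cacc (St done (c₀ :: rest)) c₀ rest with hP
      have hPv : ∀ r, r ≠ K.cur → r ≠ K.j1 → r ≠ K.cacc → r ≠ K.acc → P r = T r := by
        intro r h1 h2 h3 h4
        simp [hP, famPre, hSt, Function.update_of_ne h1, Function.update_of_ne h2,
          Function.update_of_ne h3, Function.update_of_ne h4]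
      -- bring the clause in reading order
      have e1 := runs_pour (a := K.cacc) (b := K.c) (by decide) P
      have hPcacc : P K.cacc = (cbody c₀).reverse := by simp [hP, famPre, hSt, hcacc]
      have hPc : P K.c = [] := by rw [hPv K.c (by decide) (by decide) (by decide) (by decide), hc]
      rw [hPcacc, hPc, List.length_reverse, List.reverse_reverse, List.append_nil] at e1
      set P₁ := Function.update (Function.update P K.cacc []) K.c (cbody c₀) with hP₁
      have hP₁v : ∀ r, r ≠ K.cur → r ≠ K.j1 → r ≠ K.cacc → r ≠ K.acc → r ≠ K.c → P₁ r = T r := by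
        intro r h1 h2 h3 h4 h5
        rw [hP₁, Function.update_of_ne h5, Function.update_of_ne h3, hPv r h1 h2 h3 h4]
      have hP₁acc : P₁ K.acc = wFam A := by simp [hP₁, hP, famPre, hSt, hA]
      have hclean₁ : Clean P₁ := clean_of_forall fun r hr => by
        simp only [scratch, List.mem_cons, List.not_mem_nil, or_false] at hr
        rcases hr with rfl | rfl | rfl | rfl | rfl | rfl | rfl | rfl <;>
          (rw [hP₁v _ (by decide) (by decide) (by decide) (by decide) (by decide)]; assumption)
      -- first pass
      have e2 := runs_thetaPass1 A c₀ L kk hLa hka hLc hkc P₁ hP₁acc (by simp [hP₁])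
        (by rw [hP₁v K.pt (by decide) (by decide) (by decide) (by decide) (by decide), hpt])
        (by rw [hP₁v K.acc2 (by decide) (by decide) (by decide) (by decide) (by decide), hacc2])
        (by rw [hP₁v K.d (by decide) (by decide) (by decide) (by decide) (by decide), hd])
        (by rw [hP₁v K.drop (by decide) (by decide) (by decide) (by decide) (by decide), hdrop])
        hclean₁
      set N := A.countP (fun d => d ⊆ c₀) with hN
      set P₂ := Function.update P₁ K.drop (unary N) with hP₂
      have hP₂v : ∀ r, r ≠ K.cur → r ≠ K.j1 → r ≠ K.cacc → r ≠ K.acc → r ≠ K.c → r ≠ K.drop →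
          P₂ r = T r := by
        intro r h1 h2 h3 h4 h5 h6
        rw [hP₂, Function.update_of_ne h6, hP₁v r h1 h2 h3 h4 h5]
      -- branch on the outcome
      have hNpos : 0 < N ↔ ∃ d ∈ A, d ⊆ c₀ := by
        rw [hN, List.countP_pos_iff]; simp
      set P₃ := Function.update (Function.update (Function.update P₂ K.drop []) K.c []) K.acc
        (wFam (thetaStep A c₀)) with hP₃
      have e3 : Runs (ifTop K.drop fun o => match o with
          | some _ => clear K.drop ;; clear K.c
          | none => thetaPass2) P₂ P₃
          ((2 * F.length + 2 * W + 2) + cPass2 L kk F.length + 3) := by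
        by_cases hex : ∃ d ∈ A, d ⊆ c₀
        · have hN1 : 0 < N := hNpos.2 hex
          obtain ⟨n, hn⟩ : ∃ n, N = n + 1 := ⟨N - 1, by omega⟩
          have hk : P₂ K.drop = Γ'.blank :: unary n := by simp [hP₂, hn, unary_succ]
          have ec1 := runs_clear K.drop P₂
          rw [hk, List.length_cons, length_unary] at ec1
          have ec2 := runs_clear K.c (Function.update P₂ K.drop [])
          have hv : Function.update P₂ K.drop [] K.c = cbody c₀ := by simp [hP₂, hP₁]
          rw [hv] at ec2
          refine (Runs.ifTop_cons hk ((ec1.seq ec2).of_eq ?_ le_rfl)).mono ?_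
          · rw [hP₃, thetaStep, if_pos hex, ← hP₁acc]
            have : P₁ K.acc = Function.update (Function.update P₂ K.drop []) K.c [] K.acc := by
              simp [hP₂]
            rw [this, Function.update_eq_self]
          · have hNle : N ≤ A.length := List.countP_le_length
            omega
        · have hN0 : N = 0 := by
            have := hNpos.not.2 hex; omega
          have hk : P₂ K.drop = [] := by simp [hP₂, hN0]
          have hP₂eq : P₂ = P₁ := by
            have hv : P₁ K.drop = [] := by
              rw [hP₁v K.drop (by decide) (by decide) (by decide) (by decide) (by decide), hdrop]
            rw [hP₂, hN0, unary_zero, ← hv]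
            exact Function.update_eq_self _ _
          have hclean₂ : Clean P₂ := hP₂eq ▸ hclean₁
          have e := runs_thetaPass2 A c₀ L kk hLa hka hLc hkc P₂ (by rw [hP₂eq, hP₁acc])
            (by rw [hP₂eq]; simp [hP₁])
            (by rw [hP₂v K.pt (by decide) (by decide) (by decide)
              (by decide) (by decide) (by decide), hpt])
            (by rw [hP₂v K.keep (by decide) (by decide) (by decide)
              (by decide) (by decide) (by decide), hkeep])
            (by rw [hP₂v K.j2 (by decide) (by decide) (by decide)
              (by decide) (by decide) (by decide), hj2])
            (by rw [hP₂v K.d (by decide) (by decide) (by decide)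
              (by decide) (by decide) (by decide), hd])
            (by rw [hP₂v K.s (by decide) (by decide) (by decide)
              (by decide) (by decide) (by decide), hs])
            (by rw [hP₂v K.s2 (by decide) (by decide) (by decide)
              (by decide) (by decide) (by decide), hs2])
            hclean₂
          refine (Runs.ifTop_nil hk (e.of_eq ?_ le_rfl)).mono ?_
          · rw [hP₃, thetaStep, if_neg hex]
            have : Function.update P₂ K.drop [] = P₂ := by
              rw [← hk]; exact Function.update_eq_self _ _
            rw [this]
          · have := cPass2_mono L kk hAlen
            omega
      have := e1.seq (e2.seq e3)
      refine this.of_eq ?_ ?_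
      · rw [hP₃, hP₂, hP₁, hP]
        simp only [famPre, hSt, hA]
        funext r; cases r <;> simp [hcacc, hc, hdrop, wFam_append, wFam_cons, List.foldl_append]
      · have h1 := cPass1_mono L kk hAlen
        simp only [cThAct, ← hW] at hcW ⊢
        omega)
    F [] rfl hWF
  have hSt0 : St [] F = T := by
    funext r; cases r <;> simp [hSt, hcur, hj1, hacc]
  rw [hSt0, List.nil_append] at hpass
  set T₁ := St F [] with hT₁
  have e4 := runs_clear K.j1 T₁
  have hT₁j1 : T₁ K.j1 = (wFam F).reverse := by simp [hT₁, hSt]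
  rw [hT₁j1, List.length_reverse] at e4
  have := hpass.seq e4
  refine this.of_eq ?_ ?_
  · rw [hT₁]
    simp only [hSt, thetaL]
    funext r; cases r <;> simp [hj1]
  · have hlen : (wFam F).length ≤ (W + 2) * F.length := length_wFam_le hWF
    simp only [cTheta, ← hW]
    omega

end Literature.Computability.FineGrained.Sparsifier
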